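import Literature.Computability.AlgebraicComplexity.HI16DetSkewCircuitProofs
import Literature.Computability.AlgebraicComplexity.ConstantFreeValiant
import HarnessLib

/-!
# Skew circuits have formal degree at most their size; `VP_s⁰ ⊆ VP⁰`; `(det_n) ∈ VP⁰`

Theorem-only companion of `HI16DetSkewCircuitProofs.lean` (cell `val-lit`, seat t15) linking the
constant-free skew class `VP_s⁰` of Hüttenhain–Ikenmeyer 2016, §5 (`IsVPsZeroFamily`,
`HI16BinaryDC.lean`) with Malod's/Bürgisser's class `VP⁰` (`IsVP0Family`,
`ConstantFreeValiant.lean`: fan-in two, constants in `{0, 1, -1}`, size AND formal degree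
polynomially bounded, polynomially many variables). Honest framing: elementary class inclusions;
VP ≠ VNP is NOT proved and nothing here is progress on it.

* `ArithCircuit.formalDegree_le_size_succ_of_isSkew` — a fan-in-two SKEW circuit of size `s` has
  formal degree `≤ s + 1`: each product gate multiplies an earlier gate by an INPUT (formal degree
  `1`), so gate `i` has formal degree `≤ i + 2` (`ArithCircuit.getD_gateFormalDegrees_le_of_isSkew`).
  Printed for the weakly-skew class: Bürgisser–Landsberg–Manivel–Weyman 2011, §9.1, "the degree of
  the polynomial computed by a weakly-skew circuit is bounded by its size" (here: formal degree,
  skew circuits, the tree's gate count).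
* `IsVPsZeroFamily.isVP0Family` — **`VP_s⁰ ⊆ VP⁰`** for families in polynomially many variables
  (the tree's `IsVP0Family` carries that clause, Bürgisser 2009, Def. 2.7; `IsVPsZeroFamily` does
  not, see its docstring).
* `isDETZeroFamily_detPoly` (`(det_n) ∈ DET⁰`: the generic matrix is its own binary variable
  matrix, Hüttenhain–Ikenmeyer 2016, Def. 5.1), `isVPsZeroFamily_detPoly` (`(det_n) ∈ VP_s⁰`, by
  `isVPsZeroFamily_of_isDETZeroFamily`, ibid. Prop. 5.2), `constantFreeComplexity_detPoly_le`
  (`τ(det_n) ≤ 4 (n+1)^4`), and **`isVP0Family_detPoly : IsVP0Family (fun n => detPoly (Fin n) ℤ)`**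
  — "`Det_n ∈ VP⁰`" (Malod 2003; Tavenas 2014, §1.3, p. 18, held text
  `paper:doi-10-70675-52eccebdz020az4a8dz8517z14d4aa632482 p0023.txt:L45`: "En particulier :
  `Det_n ∈ VP0` et `Perm_n, Ham_n ∈ VNP0`"), which the tree's constant-free corner
  (`ConstantFreeValiant`, `KoiranCriterion`, `BurgisserTransfer`, `PermanentVNP0`) did not yet
  record for the determinant.

Positional lemmas for the fold `gateFormalDegrees` (`gateFormalDegrees_take_eq_take`,
`gateFormalDegrees_getElem?_of_eq`) mirror `CircuitGateSemantics.gateValues_take_eq_take` /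
`gateValues_getElem?`. No named facts; all proofs complete.

## References

* [BurgisserEtAl2011] P. Bürgisser, J. M. Landsberg, L. Manivel, J. Weyman, *An overview of
  mathematical issues arising in the geometric complexity theory approach to VP ≠ VNP*, SIAM J.
  Comput. 40 (2011), §9.1.
* [Burgisser2006] P. Bürgisser, *On defining integers …*, ECCC TR06-113 = Comput. Complexity 18
  (2009), §2.2, Def. 2.7 (`VP⁰`, formal degree).
* [Tavenas2014] S. Tavenas, *Bornes inférieures et supérieures dans les circuits arithmétiques*,
  thèse, ENS Lyon 2014, §1.3 "Classes sans constantes", p. 18 (`Det_n ∈ VP⁰`).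
* [HuttenhainIkenmeyer2016] J. Hüttenhain, C. Ikenmeyer, arXiv:1410.8202, §5, Def. 5.1, Prop. 5.2.
* [MahajanVinay1997] M. Mahajan, V. Vinay, Chicago J. TCS 1997, §3 (the determinant circuit).
-/

noncomputable section

open MvPolynomial

namespace Literature.Computability.AlgebraicComplexity

universe u v

namespace ArithCircuit

variable {k : Type u} {σ : Type v}

/-! ## Positional lemmas for the formal-degree fold -/

/-- The formal-degree list of a prefix of the gate list is the prefix of the formal-degree list
(each gate reads only the gates before it; Bürgisser 2009, §2.2). [cite: Burgisser2006, §2.2] -/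
theorem gateFormalDegrees_take_eq_take (gs : List (Gate k σ)) (i : ℕ) :
    gateFormalDegrees (gs.take i) = (gateFormalDegrees gs).take i := by
  induction gs using List.reverseRecOn generalizing i with
  | nil => simp [gateFormalDegrees]
  | append_singleton gs g ih =>
    by_cases hi : i ≤ gs.length
    · rw [List.take_append_of_le_length hi, ih, gateFormalDegrees_append_singleton,
        List.take_append_of_le_length (by rwa [gateFormalDegrees_length])]
    · push Not at hi
      have h1 : (gs ++ [g]).take i = gs ++ [g] :=
        List.take_of_length_le (by simp; omega)
      have h2 : (gateFormalDegrees (gs ++ [g])).take i = gateFormalDegrees (gs ++ [g]) :=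
        List.take_of_length_le (by rw [gateFormalDegrees_length]; simp; omega)
      rw [h1, h2]

/-- **Per-gate formal degree**: the formal degree recorded for gate `i` is its gate rule applied to
the formal degrees of the gates before it (Bürgisser 2009, §2.2). [cite: Burgisser2006, §2.2] -/
theorem gateFormalDegrees_getElem?_of_eq (gs : List (Gate k σ)) (i : ℕ) (g : Gate k σ)
    (hg : gs[i]? = some g) :
    (gateFormalDegrees gs)[i]? = some (g.formalDegree (gateFormalDegrees (gs.take i))) := by
  have hi : i < gs.length := (List.getElem?_eq_some_iff.1 hg).1
  have h := gateFormalDegrees_take_eq_take gs (i + 1)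
  rw [List.take_add_one, hg, Option.toList_some, gateFormalDegrees_append_singleton] at h
  have hlen : (gateFormalDegrees (gs.take i)).length = i := by
    rw [gateFormalDegrees_length, List.length_take, min_eq_left hi.le]
  have lhs : (gateFormalDegrees (gs.take i) ++ [g.formalDegree (gateFormalDegrees (gs.take i))])[i]? =
      some (g.formalDegree (gateFormalDegrees (gs.take i))) := by
    rw [List.getElem?_append_right (by omega), hlen, Nat.sub_self, List.getElem?_cons_zero]
  rw [h, List.getElem?_take, if_pos (Nat.lt_succ_self i)] at lhs
  exact lhs

/-! ## Skew circuits: formal degree `≤ size + 1` -/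

/-- An operand read against the first `i` formal degrees has formal degree `≤ B` as soon as
`1 ≤ B` and every earlier gate has formal degree `≤ B` (junk references get the default `1`).
[cite: Burgisser2006, §2.2] -/
theorem Operand.formalDegree_take_le (degs : List ℕ) {i B : ℕ} (hB : 1 ≤ B)
    (hdeg : ∀ j < i, degs.getD j 1 ≤ B) (u : Operand k σ) :
    u.formalDegree (degs.take i) ≤ B := by
  cases u with
  | var _ => exact hB
  | const _ => exact hB
  | gate j =>
    simp only [Operand.formalDegree, List.getD_eq_getElem?_getD, List.getElem?_take]
    split_ifs with h
    · have := hdeg j h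
      rwa [List.getD_eq_getElem?_getD] at this
    · exact hB

/-- An input operand (a variable or a constant) has formal degree `1`. [cite: Burgisser2006, §2.2] -/
theorem Operand.formalDegree_of_isGateRef_false (degs : List ℕ) {u : Operand k σ}
    (hu : u.isGateRef = false) : u.formalDegree degs = 1 := by
  cases u with
  | var _ => rfl
  | const _ => rfl
  | gate j => simp [Operand.isGateRef] at hu

/-- A `foldr max 0` of a list all of whose entries are `≤ B` is `≤ B`. [folklore] -/
private theorem foldr_max_le {l : List ℕ} {B : ℕ} (h : ∀ x ∈ l, x ≤ B) : l.foldr max 0 ≤ B := by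
  induction l with
  | nil => exact Nat.zero_le _
  | cons a l ih =>
    simp only [List.foldr_cons]
    exact max_le (h a (by simp)) (ih fun x hx => h x (by simp [hx]))

/-- **In a fan-in-two skew circuit, gate `i` has formal degree at most `i + 2`**: a sum gate takes
the maximum of earlier degrees (`≤ i + 1`), a skew product multiplies one earlier gate (`≤ i + 1`)
by an input (`1`) — BLMW 2011 §9.1 ("the degree … is bounded by its size"), Bürgisser 2009 §2.2
(formal degree). [cite: BurgisserEtAl2011, §9.1] -/
theorem getD_gateFormalDegrees_le_of_isSkew (P : ArithCircuit k σ) (h2 : P.IsFanInTwo)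
    (hs : P.IsSkew) (i : ℕ) (hi : i < P.size) : (gateFormalDegrees P.gates).getD i 1 ≤ i + 2 := by
  induction i using Nat.strong_induction_on with
  | _ i ih =>
    have hi' : i < P.gates.length := hi
    obtain ⟨g, hg⟩ : ∃ g, P.gates[i]? = some g := ⟨P.gates[i], List.getElem?_eq_getElem hi'⟩
    have hmem : g ∈ P.gates := List.mem_of_getElem? hg
    rw [List.getD_eq_getElem?_getD, gateFormalDegrees_getElem?_of_eq P.gates i g hg, Option.getD_some,
      gateFormalDegrees_take_eq_take]
    -- every operand of gate `i` has formal degree `≤ i + 1`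
    have hop : ∀ u : Operand k σ, u.formalDegree ((gateFormalDegrees P.gates).take i) ≤ i + 1 :=
      fun u => Operand.formalDegree_take_le _ (by omega)
        (fun j hj => (ih j hj (lt_trans hj hi)).trans (by omega)) u
    cases g with
    | sum args =>
      simp only [Gate.formalDegree]
      refine (foldr_max_le fun x hx => ?_).trans (Nat.le_succ _)
      simp only [List.mem_map] at hx
      obtain ⟨a, _, rfl⟩ := hx
      exact hop a.2
    | prod args =>
      have hfan : args.length ≤ 2 := by
        have := h2 _ hmem
        simpa [Gate.fanIn, Gate.args] using this
      have hskew : args.countP Operand.isGateRef ≤ 1 := hs _ hmem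
      simp only [Gate.formalDegree]
      match args, hfan, hskew with
      | [], _, _ => simp
      | [u], _, _ => simpa using (hop u).trans (Nat.le_succ _)
      | [u, v], _, hsk =>
        simp only [List.map_cons, List.map_nil, List.sum_cons, List.sum_nil, add_zero]
        rw [List.countP_cons, List.countP_cons, List.countP_nil] at hsk
        cases hu : u.isGateRef
        · rw [Operand.formalDegree_of_isGateRef_false _ hu]
          have := hop v
          omega
        · cases hv : v.isGateRef
          · rw [Operand.formalDegree_of_isGateRef_false _ hv]
            have := hop u
            omega
          · simp [hu, hv] at hsk
      | _ :: _ :: _ :: _, hf, _ => simp at hf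

/-- **A fan-in-two skew circuit has formal degree at most its size plus one** (BLMW 2011 §9.1:
"the degree of the polynomial computed by a weakly-skew circuit is bounded by its size"; here the
formal degree of Bürgisser 2009 §2.2 and skew circuits). [cite: BurgisserEtAl2011, §9.1] -/
theorem formalDegree_le_size_succ_of_isSkew (P : ArithCircuit k σ) (h2 : P.IsFanInTwo)
    (hs : P.IsSkew) : P.formalDegree ≤ P.size + 1 := by
  unfold formalDegree
  cases ho : P.output with
  | var _ => exact Nat.le_add_left 1 _
  | const _ => exact Nat.le_add_left 1 _
  | gate j =>
    simp only [Operand.formalDegree]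
    by_cases hj : j < P.size
    · exact (getD_gateFormalDegrees_le_of_isSkew P h2 hs j hj).trans (by omega)
    · rw [List.getD_eq_getElem?_getD, List.getElem?_eq_none_iff.2
        (by rw [gateFormalDegrees_length]; exact not_lt.1 hj), Option.getD_none]
      exact Nat.le_add_left 1 _

end ArithCircuit

/-! ## `VP_s⁰ ⊆ VP⁰` and the determinant -/

section Classes

open ArithCircuit

/-- **`VP_s⁰ ⊆ VP⁰`** for families in polynomially many variables: constant-free skew circuits of
polynomial size have polynomial formal degree (`formalDegree_le_size_succ_of_isSkew`), which is
all that Bürgisser's `VP⁰` (2009, Def. 2.7) asks beyond `VP_s⁰` (Hüttenhain–Ikenmeyer 2016, §5) —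
plus the p-boundedness of the number of variables, which the tree's `IsVP0Family` carries and
`IsVPsZeroFamily` does not. [cite: Burgisser2006, Def. 2.7] -/
theorem IsVPsZeroFamily.isVP0Family {ς : ℕ → Type*} [∀ n, Fintype (ς n)]
    {f : ∀ n, MvPolynomial (ς n) ℤ} (hf : IsVPsZeroFamily f)
    (hς : IsPBounded fun n => Fintype.card (ς n)) : IsVP0Family f := by
  obtain ⟨P, hP, hsize⟩ := hf
  refine ⟨hς, P, fun n => ⟨(hP n).1, (hP n).2.1, (hP n).2.2.2⟩, hsize, ?_⟩
  obtain ⟨a, b, hab⟩ := (IsPBounded.iff_exists_le_mul_succ_pow _).1 hsize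
  refine (IsPBounded.iff_exists_le_mul_succ_pow _).2 ⟨a + 1, b, fun n => ?_⟩
  have h1 : 1 ≤ (n + 1) ^ b := Nat.one_le_pow _ _ (Nat.succ_pos n)
  calc (P n).formalDegree ≤ (P n).size + 1 :=
        formalDegree_le_size_succ_of_isSkew _ (hP n).1 (hP n).2.2.1
    _ ≤ a * (n + 1) ^ b + (n + 1) ^ b := Nat.add_le_add (hab n) h1
    _ = (a + 1) * (n + 1) ^ b := by ring

/-- **`(det_n) ∈ DET⁰`**: the generic matrix `(X_{ij})` is a binary variable matrix of size `n` with
determinant `det_n` (Hüttenhain–Ikenmeyer 2016, Def. 5.1; `bdc(det_n) ≤ n`).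
[cite: HuttenhainIkenmeyer2016, Def. 5.1] -/
theorem isDETZeroFamily_detPoly : IsDETZeroFamily (fun n => detPoly (Fin n) ℤ) := by
  refine ⟨_root_.id, IsPBounded.id, fun n => ⟨Matrix.mvPolynomialX (Fin n) (Fin n) ℤ, ?_, rfl⟩⟩
  intro i j
  exact Or.inr (Or.inr ⟨(i, j), rfl⟩)

/-- **`(det_n) ∈ VP_s⁰`** (Hüttenhain–Ikenmeyer 2016, Prop. 5.2: `DET⁰ ⊆ VP_s⁰`, and
`(det_n) ∈ DET⁰`). [cite: HuttenhainIkenmeyer2016, Prop. 5.2] -/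
theorem isVPsZeroFamily_detPoly : IsVPsZeroFamily (fun n => detPoly (Fin n) ℤ) :=
  isVPsZeroFamily_of_isDETZeroFamily isDETZeroFamily_detPoly

/-- **`τ(det_n) ≤ 4 (n+1)^4`**: the constant-free (fan-in-two, constants in `{0, 1, -1}`) complexity
of the generic determinant is at most the size of the Mahajan–Vinay skew circuit
(`exists_skew_circuit_detPoly`). [cite: MahajanVinay1997, §3 Thm 2] -/
theorem constantFreeComplexity_detPoly_le (n : ℕ) :
    constantFreeComplexity (detPoly (Fin n) ℤ) ≤ 4 * (n + 1) ^ 4 := by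
  obtain ⟨P, h1, h2, -, h4, h5⟩ := exists_skew_circuit_detPoly n
  refine (Nat.sInf_le ?_).trans h5
  exact ⟨P, h1, h2, h4, rfl⟩

/-- **`(det_n) ∈ VP⁰`** (Malod 2003; Tavenas 2014, §1.3, p. 18: "`Det_n ∈ VP0`"): the determinant
family has constant-free fan-in-two circuits of polynomially bounded size and formal degree, in
`n²` variables — by `VP_s⁰ ⊆ VP⁰` and `(det_n) ∈ VP_s⁰`.
[cite: Tavenas2014, §1.3 (p. 18)] -/
theorem isVP0Family_detPoly : IsVP0Family (fun n => detPoly (Fin n) ℤ) := by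
  refine isVPsZeroFamily_detPoly.isVP0Family ?_
  refine ⟨2, fun n => ?_⟩
  simp only [Fintype.card_prod, Fintype.card_fin]
  nlinarith

end Classes

end Literature.Computability.AlgebraicComplexity
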